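/-
Copyright: cell `pub-balaban-gaps` (G2), seat ne6 (row NE7b), `prover-pub-balaban-gaps-ne6-g18-0`. Project licence.
-/
import Summits.QuantumFields.BalabanUV.T4Continuum.Spine.NE7b.CompactFibreHalvedActionSUN
import Summits.QuantumFields.BalabanUV.T4Continuum.Spine.NE7b.CompactFibreProfileVolumeSUN
import Summits.QuantumFields.BalabanUV.T4Continuum.Spine.NE7c.LiveFactorWindowTight
import Mathlib.MeasureTheory.Integral.DominatedConvergence
import Mathlib.Analysis.SpecialFunctions.Gamma.Basic
import Mathlib.Analysis.SpecialFunctions.Gaussian.GaussianIntegral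
import Mathlib.Analysis.SpecialFunctions.ImproperIntegrals

/-!
# THE CONSTANT OF THE `β^{−(N²−1)∕2}` LAW FOR EVERY `N`, WITHOUT WEYL: an ABELIAN theorem for the one-plaquette mass —
# `(√β)^d·∫ e^{−β·Re tr(1−V)} dHaar_{SU(N)}(V) → C·Γ(d∕2 + 1)` whenever `Haar_{SU(N)}{Re tr(1−V) ≤ t}∕(√t)^d → C` (`t → 0⁺`),
# and for `N = 2` UNCONDITIONALLY `(√β)³·Z_{SU(2)}(β) → (2∕(3π))·Γ(5∕2) = (2√π)⁻¹` (row NE7b, node U5c; MODEL, [folklore]; census V48)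

Cell `pub-balaban-gaps` (G2 spine census) for the `pub-balaban` T⁴ crux NE7b (`T4WeightBudget.RelWeightBound`; NOT PRINTED, NOT PROVED).  Crux-route work under
`Spine/NE7b/`; imports this lineage's V38 `CompactFibreHalvedActionSUN` (measurability of the deficit `Re tr(1 − V)`) and V35 `CompactFibreProfileVolumeSUN`
(`re_trace_one_sub_nonneg`), seat ne8's landed `Spine/NE7c/LiveFactorWindowTight` (its `tendsto_window_div_sqrt_cube`: `Haar_{SU(2)}{Re tr(1−V) ≤ t}∕(√t)³ → 2∕(3π)`,
real analysis on V40a's exact cap law — consumed BY NAME) + Mathlib (Tonelli, dominated convergence, `Real.Gamma_eq_integral`, `Real.Gamma_one_half_eq`);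
no `def`, zero `sorry`, nothing of Bałaban's asserted; V45's two `N = 2` theorems are NOT restated (the tree has them) — §3 reaches their constant in this
file's native form `(window constant)·Γ(5∕2)` and records the arithmetic identity between the two forms.

THE LOCATED QUESTION (census V48).  V39 proved the RATE `−log Z_N(β)∕log β → (N² − 1)∕2` of the one-plaquette mass `Z_N(β) = ∫ e^{−β·Re tr(1−V)} dHaar_{SU(N)}(V)`
with SOFT two-sided constants; V45 identified THE constant for `N = 2`, `β^{3∕2}·Z_{SU(2)}(β) → (2√π)⁻¹`, by dominated convergence in WEYL's variable — a route that
for `N ≥ 3` needs the rank-`(N−1)` Weyl integration formula (absent; the standing «real reason» of V40b ∕ V41 ∕ V44 ∕ V45).  QUESTION: is there a constant for EVERY `N`,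
and what is it, WITHOUT Weyl?

ANSWER ([folklore]; an Abelian theorem for the Laplace transform of the window-volume function):
* §1 ABSTRACT (finite measure space, deficit `s ≥ 0` measurable, window-volume function `m(t) = μ{s ≤ t}`):
  **`integral_exp_neg_mul_eq_integral_window`** — the LAYER CAKE in Laplace form, `∫ e^{−β·s} dμ = ∫_{(0,∞)} e^{−u}·m(u∕β) du` (`β > 0`; Tonelli on
  `e^{−βs} = ∫_{u ≥ βs} e^{−u} du`);
  **`tendsto_sqrt_pow_mul_integral_exp_neg_mul`** — THE ABELIAN THEOREM: if `m(t)∕(√t)^d → C` as `t → 0⁺` (`d : ℕ`), then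
  `(√β)^d·∫ e^{−β·s} dμ → C·Γ(d∕2 + 1)` as `β → ∞` (dominated convergence on `(0,∞)` against `M·(√u)^d·e^{−u}`, `M` = the sup of `m(t)∕(√t)^d`, finite
  because the ratio converges at `0⁺` and `m ≤ μ(univ)` away from `0`; the limit integrand is `C·(√u)^d·e^{−u}`, whose integral is Euler's `Γ(d∕2 + 1)`).
* §2 `SU(N)`, EVERY `N`, the window constant as HYPOTHESIS (no chart, no Weyl): **`tendsto_scaled_plaquetteMass_SUN_of_window`** — if
  `Haar_{SU(N)}{Re tr(1−V) ≤ t}∕(√t)^d → C` then `(√β)^d·Z_N(β) → C·Γ(d∕2 + 1)` (in use `d = N² − 1 = dim SU(N)`); `plaquetteMass_SUN_pos` (`Z_N(β) > 0`);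
  **`eventually_lt_plaquetteMass_SUN_of_window`** ∕ **`eventually_plaquetteMass_SUN_lt_of_window`** (every `c < C·Γ` is eventually a floor, every `c > C·Γ`
  eventually a ceiling of `Z_N(β)·β^{d∕2}`); **`tendsto_freeEnergy_constant_SUN_of_window`** (`C > 0`): `−log Z_N(β) − (d∕2)·log β → −log(C·Γ(d∕2 + 1))` —
  V39's `∃ c₁` IDENTIFIED in the limit for every `N`, as the window constant times Euler's factor.
* §3 `N = 2` UNCONDITIONAL: **`tendsto_scaled_plaquetteMass_SU2_of_window`**: `(√β)³·Z_{SU(2)}(β) → (2∕(3π))·Γ(3∕2 + 1)` from ne8's window constant `2∕(3π)`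
  (no chart, no Weyl), and the arithmetic `Γ(5∕2) = 3√π∕4` (`Gamma_five_halves`), **`window_const_mul_Gamma_five_halves_eq`**: `(2∕(3π))·Γ(3∕2 + 1) = (2√π)⁻¹` —
  so the limit IS V45's `tendsto_scaled_plaquetteMass_SU2` constant `(2√π)⁻¹ = 0.28209…` (V45: dominated convergence in Weyl's variable; here: window constant ×
  Euler's factor): the CONSISTENCY CHECK of ne8's window constant against Weyl's density, the two routes agreeing to the digit.
* §4 (v1.1, append-only) THE NON-ASYMPTOTIC CEILING WITH EULER's FACTOR: **`integral_exp_neg_mul_le_of_window_le`** — if `μ{s ≤ t} ≤ M·(√t)^d` for ALL `t > 0`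
  then `∫ e^{−β·s} dμ ≤ M·Γ(d∕2 + 1)·((√β)⁻¹)^d` for EVERY `β > 0` (the Laplace-form layer cake of §1, no limit taken); **`plaquetteMass_SUN_le_of_window_le`** — the
  `SU(N)` form: a window-volume ceiling at all levels gives the one-plaquette mass ceiling at every coupling with the SHARP factor `Γ(d∕2 + 1)` (for `N = 2`, V42's ceiling
  `(2∕(3π))(√t)³` at every `t ≥ 0` gives `Z_{SU(2)}(β) ≤ (2√π)⁻¹β^{−3∕2}` — J3's `plaquetteMass_SU2_le_sharp`, not restated).
* The all-`N` EXISTENTIAL form (`∃ c_N > 0, β^{(N²−1)∕2}·Z_N(β) → c_N`, `c_N = (√2)^{N²−1}·C₀(N)·Γ((N²+1)∕2)` with `C₀(N)` the tree's exact Hilbert–Schmidt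
  small-ball constant of `SU(N)`, `Summits/Ventures/LatticeQCDFlow/Scaling/SpecialUnitarySmallBall`) is the junction with seat ne8's file 36
  `Spine/NE7c/LiveFactorWindowTightSUN.tendsto_haar_traceWindow_div_sqrt_pow` (INTENT I-gapsne8-g16-1) — filed separately once that file is built; not restated here.

HONEST REMARKS.  (i) MODEL ∕ [folklore]: ONE plaquette variable under Haar (the compact-fibre carrier's product reference state factorises); nothing of the
interacting measure.  (ii) The window constant `C` is a HYPOTHESIS in §2 (discharged for `N = 2` in §3 by name from the tree; for every `N` by the junction
named above); no value of `C₀(N)` for `N ≥ 3` is claimed.  (iii) No rate of convergence.  (iv) (A3) ∕ (A1c) NOT asserted; NC-NE7b-α UNRULED.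
BY-NAME EFFECT ON THE WALL: NONE.  NE7b NOT PRINTED ∕ NOT PROVED; spine PROVED 0∕9; rung (B)+1 on ONE finite T⁴ — NOT infinite volume, NOT the mass gap, NOT Clay.
HONEST DEPENDENCY: continuum YM on T⁴ ⇐ BetaPertH ∧ nine spine estimates (0/9 proved); BetaPertH ⇐ (D1) ∧ (D4) ∧ CAP+tail;
G-an2-4 gates asym, D1 and NE2/3/4.  This file changes none of it.
-/

set_option autoImplicit false

noncomputable section

open MeasureTheory Real Set Filter Topology
open scoped Matrix.Norms.Frobenius ENNReal
open Literature.MathematicalPhysics.QuantumFieldTheory (haarProbability)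
open Summit.QuantumFields.BalabanUV.T4Continuum.NE7b.CompactFibreHalvedActionSUN (measurable_re_trace_one_sub)
open Summit.QuantumFields.BalabanUV.T4Continuum.NE7b.CompactFibreProfileVolumeSUN (re_trace_one_sub_nonneg)
open Summit.QuantumFields.BalabanUV.T4Continuum.Spine.NE7c.LiveFactorWindowTight (tendsto_window_div_sqrt_cube)

namespace Summit.QuantumFields.BalabanUV.T4Continuum.NE7b.CompactFibrePlaquetteMassSUNLimit

/-! ## §1 The abstract Abelian theorem: the Laplace transform of a window-volume function with a power law at `0⁺` -/

section Abelian

variable {X : Type*} [MeasurableSpace X] (μ : Measure X) [IsFiniteMeasure μ]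

/-- **LAYER CAKE IN LAPLACE FORM.**  On a finite measure space, for `s ≥ 0` measurable and `β > 0`:
`∫ e^{−β·s} dμ = ∫_{(0,∞)} e^{−u}·μ{s ≤ u∕β} du` (Tonelli on `e^{−β s(x)} = ∫_{u ≥ β s(x)} e^{−u} du`). [folklore] -/
theorem integral_exp_neg_mul_eq_integral_window {s : X → ℝ} (hs : Measurable s) (hs0 : ∀ x, 0 ≤ s x) {β : ℝ} (hβ : 0 < β) :
    ∫ x, Real.exp (-(β * s x)) ∂μ = ∫ u in Set.Ioi (0 : ℝ), Real.exp (-u) * μ.real {x | s x ≤ u / β} := by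
  -- the window `{s ≤ u/β} = {β·s ≤ u}`, measurable, monotone in `u`
  have hwin : ∀ u : ℝ, {x | s x ≤ u / β} = {x | β * s x ≤ u} := fun u => by
    ext x; simp only [Set.mem_setOf_eq]; rw [le_div_iff₀ hβ, mul_comm]
  have hW : ∀ u : ℝ, MeasurableSet {x | s x ≤ u / β} := fun u => measurableSet_le hs measurable_const
  have hmono : Monotone fun u : ℝ => μ.real {x | s x ≤ u / β} := fun u v huv =>
    measureReal_mono (fun x (hx : s x ≤ u / β) => hx.trans (div_le_div_of_nonneg_right huv hβ.le))
  -- the joint integrand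
  set F : X → ℝ → ℝ≥0∞ := fun x u => if β * s x ≤ u then ENNReal.ofReal (Real.exp (-u)) else 0 with hFdef
  have hFmeas : Measurable (Function.uncurry F) := by
    refine Measurable.ite ?_ (ENNReal.measurable_ofReal.comp (Real.measurable_exp.comp measurable_snd.neg)) measurable_const
    exact measurableSet_le ((hs.comp measurable_fst).const_mul β) measurable_snd
  -- inner `u`-integral: `e^{−β s(x)} = ∫_{u ≥ β s(x)} e^{−u} du`
  have hinner : ∀ x : X, ENNReal.ofReal (Real.exp (-(β * s x))) = ∫⁻ u, F x u := fun x => by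
    have hF : (fun u => F x u) = (Set.Ici (β * s x)).indicator (fun u => ENNReal.ofReal (Real.exp (-u))) := by
      funext u; simp only [hFdef, Set.indicator_apply, Set.mem_Ici]
    have hint : IntegrableOn (fun u : ℝ => Real.exp (-u)) (Set.Ici (β * s x)) :=
      (integrableOn_exp_neg_Ioi (β * s x - 1)).mono_set (Set.Ici_subset_Ioi.2 (by linarith))
    rw [hF, lintegral_indicator measurableSet_Ici, ← ofReal_integral_eq_lintegral_ofReal hint (ae_of_all _ fun u => (Real.exp_pos _).le),
      integral_Ici_eq_integral_Ioi, integral_exp_neg_Ioi]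
  -- inner `x`-integral: the window mass
  have hslice : ∀ u : ℝ, ∫⁻ x, F x u ∂μ = ENNReal.ofReal (Real.exp (-u)) * μ {x | s x ≤ u / β} := fun u => by
    have hF : (fun x => F x u) = ({x | s x ≤ u / β}).indicator (fun _ => ENNReal.ofReal (Real.exp (-u))) := by
      funext x; rw [hwin u]; simp only [hFdef, Set.indicator_apply, Set.mem_setOf_eq]
    rw [hF, lintegral_indicator_const (hW u)]
  -- Tonelli
  have hswap : ∫⁻ x, ∫⁻ u, F x u ∂volume ∂μ = ∫⁻ u, ∫⁻ x, F x u ∂μ ∂volume := lintegral_lintegral_swap hFmeas.aemeasurable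
  -- back to real integrals
  have hmeasL : Measurable fun x => Real.exp (-(β * s x)) := Real.measurable_exp.comp ((hs.const_mul β).neg)
  have hLHS : ∫ x, Real.exp (-(β * s x)) ∂μ = (∫⁻ x, ENNReal.ofReal (Real.exp (-(β * s x))) ∂μ).toReal :=
    integral_eq_lintegral_of_nonneg_ae (ae_of_all _ fun x => (Real.exp_pos _).le) hmeasL.aestronglyMeasurable
  have hg_meas : Measurable fun u : ℝ => Real.exp (-u) * μ.real {x | s x ≤ u / β} :=
    (Real.measurable_exp.comp measurable_neg).mul hmono.measurable
  have hRHS : ∫ u, Real.exp (-u) * μ.real {x | s x ≤ u / β} = (∫⁻ u, ENNReal.ofReal (Real.exp (-u) * μ.real {x | s x ≤ u / β})).toReal :=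
    integral_eq_lintegral_of_nonneg_ae (ae_of_all _ fun u => mul_nonneg (Real.exp_pos _).le measureReal_nonneg) hg_meas.aestronglyMeasurable
  have hprod : ∀ u : ℝ, ENNReal.ofReal (Real.exp (-u) * μ.real {x | s x ≤ u / β}) = ENNReal.ofReal (Real.exp (-u)) * μ {x | s x ≤ u / β} := fun u => by
    rw [ENNReal.ofReal_mul (Real.exp_pos _).le, ofReal_measureReal]
  -- the integrand vanishes for `u < 0`
  have hvan : ∀ u, u ∉ Set.Ici (0 : ℝ) → Real.exp (-u) * μ.real {x | s x ≤ u / β} = 0 := fun u hu => by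
    have hu' : u < 0 := lt_of_not_ge hu
    have hempty : {x | s x ≤ u / β} = ∅ := Set.eq_empty_of_forall_notMem fun x hx => by
      have h1 : u / β < 0 := div_neg_of_neg_of_pos hu' hβ
      have h2 : s x ≤ u / β := hx
      linarith [hs0 x]
    rw [hempty, measureReal_empty, mul_zero]
  calc ∫ x, Real.exp (-(β * s x)) ∂μ = (∫⁻ x, ENNReal.ofReal (Real.exp (-(β * s x))) ∂μ).toReal := hLHS
    _ = (∫⁻ x, ∫⁻ u, F x u ∂volume ∂μ).toReal := by simp_rw [hinner]
    _ = (∫⁻ u, ∫⁻ x, F x u ∂μ ∂volume).toReal := by rw [hswap]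
    _ = (∫⁻ u, ENNReal.ofReal (Real.exp (-u) * μ.real {x | s x ≤ u / β}) ∂volume).toReal := by simp_rw [hslice, hprod]
    _ = ∫ u, Real.exp (-u) * μ.real {x | s x ≤ u / β} := hRHS.symm
    _ = ∫ u in Set.Ici 0, Real.exp (-u) * μ.real {x | s x ≤ u / β} := (setIntegral_eq_integral_of_forall_compl_eq_zero hvan).symm
    _ = ∫ u in Set.Ioi 0, Real.exp (-u) * μ.real {x | s x ≤ u / β} := integral_Ici_eq_integral_Ioi

/-- `(√u)^d = u^{d∕2}` for `u ≥ 0` (natural power of the square root as a real power). -/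
theorem sqrt_pow_eq_rpow {u : ℝ} (hu : 0 ≤ u) (d : ℕ) : Real.sqrt u ^ d = u ^ ((d : ℝ) / 2) := by
  rw [Real.sqrt_eq_rpow, ← Real.rpow_natCast, ← Real.rpow_mul hu]
  congr 1; ring

/-- Euler: `∫_{(0,∞)} e^{−u}·(√u)^d du = Γ(d∕2 + 1)`. [folklore] -/
theorem integral_exp_neg_mul_sqrt_pow (d : ℕ) :
    ∫ u in Set.Ioi (0 : ℝ), Real.exp (-u) * Real.sqrt u ^ d = Real.Gamma ((d : ℝ) / 2 + 1) := by
  rw [Real.Gamma_eq_integral (by positivity)]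
  refine setIntegral_congr_fun measurableSet_Ioi fun u hu => ?_
  rw [sqrt_pow_eq_rpow (le_of_lt hu), add_sub_cancel_right]

/-- `u ↦ e^{−u}·(√u)^d` is integrable on `(0,∞)` (Euler's integral converges). [folklore] -/
theorem integrableOn_exp_neg_mul_sqrt_pow (d : ℕ) :
    IntegrableOn (fun u : ℝ => Real.exp (-u) * Real.sqrt u ^ d) (Set.Ioi 0) := by
  have h := Real.GammaIntegral_convergent (s := (d : ℝ) / 2 + 1) (by positivity)
  refine h.congr_fun (fun u hu => ?_) measurableSet_Ioi
  rw [sqrt_pow_eq_rpow (le_of_lt hu), add_sub_cancel_right]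

/-- **THE ABELIAN THEOREM.**  On a finite measure space with a measurable deficit `s ≥ 0`: if the window-volume function has a power law at `0⁺`,
`μ{s ≤ t}∕(√t)^d → C` as `t → 0⁺` (`d : ℕ`), then the Laplace transform has the matching power law at `∞` with Euler's factor:
`(√β)^d·∫ e^{−β·s} dμ → C·Γ(d∕2 + 1)` as `β → ∞`. [folklore] -/
theorem tendsto_sqrt_pow_mul_integral_exp_neg_mul {s : X → ℝ} (hs : Measurable s) (hs0 : ∀ x, 0 ≤ s x) {d : ℕ} {C : ℝ}
    (hC : Tendsto (fun t : ℝ => μ.real {x | s x ≤ t} / Real.sqrt t ^ d) (𝓝[>] 0) (𝓝 C)) :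
    Tendsto (fun β : ℝ => Real.sqrt β ^ d * ∫ x, Real.exp (-(β * s x)) ∂μ) atTop (𝓝 (C * Real.Gamma ((d : ℝ) / 2 + 1))) := by
  -- the window-volume function
  set m : ℝ → ℝ := fun t => μ.real {x | s x ≤ t} with hmdef
  have hm_mono : Monotone m := fun t t' htt' => measureReal_mono (fun x (hx : s x ≤ t) => hx.trans htt')
  have hm_le : ∀ t, m t ≤ μ.real Set.univ := fun t => measureReal_mono (Set.subset_univ _)
  have hm_nn : ∀ t, 0 ≤ m t := fun t => measureReal_nonneg
  -- a GLOBAL bound `m(t) ≤ M·(√t)^d` for `t > 0`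
  have hev : ∀ᶠ t in 𝓝[>] (0 : ℝ), m t / Real.sqrt t ^ d < C + 1 := hC.eventually (gt_mem_nhds (lt_add_one C))
  rw [eventually_nhdsWithin_iff, Metric.eventually_nhds_iff] at hev
  obtain ⟨t₀, ht₀, hsmall⟩ := hev
  set M : ℝ := max (C + 1) (μ.real Set.univ / Real.sqrt t₀ ^ d) with hMdef
  have hst₀ : 0 < Real.sqrt t₀ ^ d := pow_pos (Real.sqrt_pos.2 ht₀) d
  have hM0 : 0 ≤ M := le_max_of_le_right (div_nonneg measureReal_nonneg hst₀.le)
  have hMbound : ∀ t : ℝ, 0 < t → m t ≤ M * Real.sqrt t ^ d := fun t ht => by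
    have hst : 0 < Real.sqrt t ^ d := pow_pos (Real.sqrt_pos.2 ht) d
    rcases lt_or_ge t t₀ with hlt | hge
    · have h1 : m t / Real.sqrt t ^ d < C + 1 := hsmall (by rwa [dist_zero_right, Real.norm_eq_abs, abs_of_pos ht]) ht
      have h2 : m t / Real.sqrt t ^ d ≤ M := h1.le.trans (le_max_left _ _)
      rwa [div_le_iff₀ hst] at h2
    · have h1 : Real.sqrt t₀ ^ d ≤ Real.sqrt t ^ d := pow_le_pow_left₀ (Real.sqrt_nonneg _) (Real.sqrt_le_sqrt hge) d
      calc m t ≤ μ.real Set.univ := hm_le t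
        _ = μ.real Set.univ / Real.sqrt t₀ ^ d * Real.sqrt t₀ ^ d := by field_simp
        _ ≤ M * Real.sqrt t₀ ^ d := mul_le_mul_of_nonneg_right (le_max_right _ _) hst₀.le
        _ ≤ M * Real.sqrt t ^ d := mul_le_mul_of_nonneg_left h1 hM0
  -- the rescaling identity `(√β)^d·m(u/β) = (√u)^d·(m(u/β)/(√(u/β))^d)`
  have hresc : ∀ β u : ℝ, 0 < β → 0 < u → Real.sqrt β ^ d * m (u / β) = Real.sqrt u ^ d * (m (u / β) / Real.sqrt (u / β) ^ d) := fun β u hβ hu => by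
    have hsβ : 0 < Real.sqrt β := Real.sqrt_pos.2 hβ
    have hsu : 0 < Real.sqrt u := Real.sqrt_pos.2 hu
    rw [Real.sqrt_div hu.le, div_pow]
    field_simp
  -- the integrands and the dominated-convergence data
  set F : ℝ → ℝ → ℝ := fun β u => Real.sqrt β ^ d * (Real.exp (-u) * m (u / β)) with hFdef
  have hF_meas : ∀ᶠ β in atTop, AEStronglyMeasurable (F β) (volume.restrict (Set.Ioi (0 : ℝ))) := by
    filter_upwards [eventually_gt_atTop (0 : ℝ)] with β hβ
    have hmono : Monotone fun u : ℝ => m (u / β) := fun u v huv => hm_mono (div_le_div_of_nonneg_right huv hβ.le)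
    exact (measurable_const.mul ((Real.measurable_exp.comp measurable_neg).mul hmono.measurable)).aestronglyMeasurable
  have h_bound : ∀ᶠ β in atTop, ∀ᵐ u ∂(volume.restrict (Set.Ioi (0 : ℝ))), ‖F β u‖ ≤ M * (Real.exp (-u) * Real.sqrt u ^ d) := by
    filter_upwards [eventually_gt_atTop (0 : ℝ)] with β hβ
    refine (ae_restrict_iff' measurableSet_Ioi).2 (ae_of_all _ fun u (hu : 0 < u) => ?_)
    have hF0 : 0 ≤ F β u := mul_nonneg (pow_nonneg (Real.sqrt_nonneg _) d) (mul_nonneg (Real.exp_pos _).le (hm_nn _))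
    rw [Real.norm_eq_abs, abs_of_nonneg hF0, hFdef]
    simp only
    have h1 : m (u / β) ≤ M * Real.sqrt (u / β) ^ d := hMbound _ (div_pos hu hβ)
    have h2 : Real.sqrt β ^ d * Real.sqrt (u / β) ^ d = Real.sqrt u ^ d := by
      rw [← mul_pow, ← Real.sqrt_mul hβ.le, mul_div_cancel₀ _ hβ.ne']
    calc Real.sqrt β ^ d * (Real.exp (-u) * m (u / β)) ≤ Real.sqrt β ^ d * (Real.exp (-u) * (M * Real.sqrt (u / β) ^ d)) :=
          mul_le_mul_of_nonneg_left (mul_le_mul_of_nonneg_left h1 (Real.exp_pos _).le) (pow_nonneg (Real.sqrt_nonneg _) d)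
      _ = M * (Real.exp (-u) * (Real.sqrt β ^ d * Real.sqrt (u / β) ^ d)) := by ring
      _ = M * (Real.exp (-u) * Real.sqrt u ^ d) := by rw [h2]
  have h_int : Integrable (fun u : ℝ => M * (Real.exp (-u) * Real.sqrt u ^ d)) (volume.restrict (Set.Ioi (0 : ℝ))) :=
    (integrableOn_exp_neg_mul_sqrt_pow d).const_mul M
  have h_lim : ∀ᵐ u ∂(volume.restrict (Set.Ioi (0 : ℝ))), Tendsto (fun β => F β u) atTop (𝓝 (C * (Real.exp (-u) * Real.sqrt u ^ d))) := by
    refine (ae_restrict_iff' measurableSet_Ioi).2 (ae_of_all _ fun u (hu : 0 < u) => ?_)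
    -- `u/β → 0⁺`, so the ratio converges to `C`
    have hdiv : Tendsto (fun β : ℝ => u / β) atTop (𝓝[>] 0) := by
      refine tendsto_nhdsWithin_iff.2 ⟨tendsto_const_nhds.div_atTop tendsto_id, ?_⟩
      filter_upwards [eventually_gt_atTop (0 : ℝ)] with β hβ using div_pos hu hβ
    have hratio : Tendsto (fun β : ℝ => m (u / β) / Real.sqrt (u / β) ^ d) atTop (𝓝 C) := hC.comp hdiv
    have hprod := hratio.const_mul (Real.exp (-u) * Real.sqrt u ^ d)
    rw [show Real.exp (-u) * Real.sqrt u ^ d * C = C * (Real.exp (-u) * Real.sqrt u ^ d) by ring] at hprod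
    refine hprod.congr' ?_
    filter_upwards [eventually_gt_atTop (0 : ℝ)] with β hβ
    rw [hFdef]
    simp only
    rw [show Real.sqrt β ^ d * (Real.exp (-u) * m (u / β)) = Real.exp (-u) * (Real.sqrt β ^ d * m (u / β)) by ring, hresc β u hβ hu]
    ring
  have hDCT := tendsto_integral_filter_of_dominated_convergence (fun u => M * (Real.exp (-u) * Real.sqrt u ^ d)) hF_meas h_bound h_int h_lim
  -- the value of the limit integral
  have hval : ∫ u in Set.Ioi (0 : ℝ), C * (Real.exp (-u) * Real.sqrt u ^ d) = C * Real.Gamma ((d : ℝ) / 2 + 1) := by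
    rw [integral_const_mul, integral_exp_neg_mul_sqrt_pow]
  rw [hval] at hDCT
  -- identify `∫ F β = (√β)^d·∫ e^{−βs} dμ` for `β > 0`
  refine hDCT.congr' ?_
  filter_upwards [eventually_gt_atTop (0 : ℝ)] with β hβ
  rw [integral_exp_neg_mul_eq_integral_window μ hs hs0 hβ, ← integral_const_mul]

end Abelian

/-! ## §2 `SU(N)`, every `N`: the one-plaquette mass constant is the window constant times `Γ(d∕2 + 1)` -/

section SUN

variable {N : ℕ}

/-- **THE ONE-PLAQUETTE MASS IS POSITIVE**: `Z_N(β) = ∫ e^{−β·Re tr(1−V)} dHaar_{SU(N)}(V) > 0` for `β ≥ 0` (a positive integrand, bounded by `1`, against a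
probability measure; V46's tangent floor `Z_N(β) ≥ e^{−Nβ}` is the quantitative form, not needed here). [folklore] -/
theorem plaquetteMass_SUN_pos {β : ℝ} (hβ : 0 ≤ β) :
    0 < ∫ V, Real.exp (-(β * (Matrix.trace (1 - (V : Matrix (Fin N) (Fin N) ℂ))).re)) ∂(haarProbability (Matrix.specialUnitaryGroup (Fin N) ℂ)) := by
  have hmeas : Measurable fun V : Matrix.specialUnitaryGroup (Fin N) ℂ => -(β * (Matrix.trace (1 - (V : Matrix (Fin N) (Fin N) ℂ))).re) :=
    (measurable_re_trace_one_sub.const_mul β).neg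
  have hint : Integrable (fun V : Matrix.specialUnitaryGroup (Fin N) ℂ => Real.exp (-(β * (Matrix.trace (1 - (V : Matrix (Fin N) (Fin N) ℂ))).re)))
      (haarProbability (Matrix.specialUnitaryGroup (Fin N) ℂ)) :=
    Integrable.of_bound (Real.measurable_exp.comp hmeas).aestronglyMeasurable 1 (ae_of_all _ fun V => by
      rw [Real.norm_eq_abs, abs_of_pos (Real.exp_pos _), Real.exp_le_one_iff, neg_nonpos]
      exact mul_nonneg hβ (re_trace_one_sub_nonneg V))
  exact integral_exp_pos hint

/-- **THE CONSTANT OF THE `β^{−d∕2}` LAW OF `SU(N)`, EVERY `N`, FROM THE WINDOW CONSTANT** (no chart, no Weyl): if the trace-window volume function of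
`SU(N)` satisfies `Haar_{SU(N)}{Re tr(1−V) ≤ t}∕(√t)^d → C` as `t → 0⁺`, then `(√β)^d·∫ e^{−β·Re tr(1−V)} dHaar_{SU(N)}(V) → C·Γ(d∕2 + 1)` as `β → ∞`
(in use `d = N² − 1 = dim SU(N)`: print's rate `½·d(𝔤)` with its constant). [folklore] -/
theorem tendsto_scaled_plaquetteMass_SUN_of_window {d : ℕ} {C : ℝ}
    (hC : Tendsto (fun t : ℝ => (haarProbability (Matrix.specialUnitaryGroup (Fin N) ℂ)).real
        {V : Matrix.specialUnitaryGroup (Fin N) ℂ | (Matrix.trace (1 - (V : Matrix (Fin N) (Fin N) ℂ))).re ≤ t} / Real.sqrt t ^ d) (𝓝[>] 0) (𝓝 C)) :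
    Tendsto (fun β : ℝ => Real.sqrt β ^ d *
        ∫ V, Real.exp (-(β * (Matrix.trace (1 - (V : Matrix (Fin N) (Fin N) ℂ))).re)) ∂(haarProbability (Matrix.specialUnitaryGroup (Fin N) ℂ)))
      atTop (𝓝 (C * Real.Gamma ((d : ℝ) / 2 + 1))) :=
  tendsto_sqrt_pow_mul_integral_exp_neg_mul (haarProbability (Matrix.specialUnitaryGroup (Fin N) ℂ)) measurable_re_trace_one_sub
    re_trace_one_sub_nonneg hC

/-- **EVERY `c < C·Γ(d∕2 + 1)` IS EVENTUALLY A FLOOR**: `c·((√β)⁻¹)^d < Z_N(β)` for all large `β`. [folklore] -/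
theorem eventually_lt_plaquetteMass_SUN_of_window {d : ℕ} {C c : ℝ}
    (hC : Tendsto (fun t : ℝ => (haarProbability (Matrix.specialUnitaryGroup (Fin N) ℂ)).real
        {V : Matrix.specialUnitaryGroup (Fin N) ℂ | (Matrix.trace (1 - (V : Matrix (Fin N) (Fin N) ℂ))).re ≤ t} / Real.sqrt t ^ d) (𝓝[>] 0) (𝓝 C))
    (hc : c < C * Real.Gamma ((d : ℝ) / 2 + 1)) :
    ∀ᶠ β : ℝ in atTop, c * ((Real.sqrt β)⁻¹) ^ d
      < ∫ V, Real.exp (-(β * (Matrix.trace (1 - (V : Matrix (Fin N) (Fin N) ℂ))).re)) ∂(haarProbability (Matrix.specialUnitaryGroup (Fin N) ℂ)) := by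
  filter_upwards [(tendsto_scaled_plaquetteMass_SUN_of_window hC).eventually_const_lt hc, eventually_gt_atTop (0 : ℝ)] with β hβ hβ0
  have hs : 0 < Real.sqrt β ^ d := pow_pos (Real.sqrt_pos.2 hβ0) d
  rw [inv_pow, ← div_eq_mul_inv, div_lt_iff₀ hs]
  linarith

/-- **EVERY `c > C·Γ(d∕2 + 1)` IS EVENTUALLY A CEILING**: `Z_N(β) < c·((√β)⁻¹)^d` for all large `β`. [folklore] -/
theorem eventually_plaquetteMass_SUN_lt_of_window {d : ℕ} {C c : ℝ}
    (hC : Tendsto (fun t : ℝ => (haarProbability (Matrix.specialUnitaryGroup (Fin N) ℂ)).real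
        {V : Matrix.specialUnitaryGroup (Fin N) ℂ | (Matrix.trace (1 - (V : Matrix (Fin N) (Fin N) ℂ))).re ≤ t} / Real.sqrt t ^ d) (𝓝[>] 0) (𝓝 C))
    (hc : C * Real.Gamma ((d : ℝ) / 2 + 1) < c) :
    ∀ᶠ β : ℝ in atTop,
      ∫ V, Real.exp (-(β * (Matrix.trace (1 - (V : Matrix (Fin N) (Fin N) ℂ))).re)) ∂(haarProbability (Matrix.specialUnitaryGroup (Fin N) ℂ))
        < c * ((Real.sqrt β)⁻¹) ^ d := by
  filter_upwards [(tendsto_scaled_plaquetteMass_SUN_of_window hC).eventually_lt_const hc, eventually_gt_atTop (0 : ℝ)] with β hβ hβ0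
  have hs : 0 < Real.sqrt β ^ d := pow_pos (Real.sqrt_pos.2 hβ0) d
  rw [inv_pow, ← div_eq_mul_inv, lt_div_iff₀ hs]
  linarith

/-- **THE FREE-ENERGY CONSTANT, EVERY `N`, FROM THE WINDOW CONSTANT**: if `Haar_{SU(N)}{Re tr(1−V) ≤ t}∕(√t)^d → C > 0` then
`−log ∫ e^{−β·Re tr(1−V)} dHaar_{SU(N)}(V) − (d∕2)·log β → −log(C·Γ(d∕2 + 1))` as `β → ∞` (V39's `|−log Z_N − ((N²−1)∕2)·log β| ≤ c₁` with the constant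
IDENTIFIED in the limit). [folklore] -/
theorem tendsto_freeEnergy_constant_SUN_of_window {d : ℕ} {C : ℝ} (hCpos : 0 < C)
    (hC : Tendsto (fun t : ℝ => (haarProbability (Matrix.specialUnitaryGroup (Fin N) ℂ)).real
        {V : Matrix.specialUnitaryGroup (Fin N) ℂ | (Matrix.trace (1 - (V : Matrix (Fin N) (Fin N) ℂ))).re ≤ t} / Real.sqrt t ^ d) (𝓝[>] 0) (𝓝 C)) :
    Tendsto (fun β : ℝ =>
        -Real.log (∫ V, Real.exp (-(β * (Matrix.trace (1 - (V : Matrix (Fin N) (Fin N) ℂ))).re)) ∂(haarProbability (Matrix.specialUnitaryGroup (Fin N) ℂ)))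
          - (d : ℝ) / 2 * Real.log β)
      atTop (𝓝 (-Real.log (C * Real.Gamma ((d : ℝ) / 2 + 1)))) := by
  have hL : 0 < C * Real.Gamma ((d : ℝ) / 2 + 1) := mul_pos hCpos (Real.Gamma_pos_of_pos (by positivity))
  have hlog := ((Real.continuousAt_log hL.ne').tendsto.comp (tendsto_scaled_plaquetteMass_SUN_of_window hC)).neg
  refine hlog.congr' ?_
  filter_upwards [eventually_gt_atTop (0 : ℝ)] with β hβ0
  have hs : 0 < Real.sqrt β := Real.sqrt_pos.2 hβ0
  have hZ := plaquetteMass_SUN_pos (N := N) hβ0.le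
  simp only [Function.comp]
  rw [Real.log_mul (pow_pos hs d).ne' hZ.ne', Real.log_pow, Real.log_sqrt hβ0.le]
  ring

end SUN

/-! ## §3 `N = 2`, UNCONDITIONALLY: `(√β)³·Z_{SU(2)}(β) → (2∕(3π))·Γ(3∕2 + 1)`, and `(2∕(3π))·Γ(3∕2 + 1) = (2√π)⁻¹` = V45's constant -/

section SU2

/-- `Γ(5∕2) = 3√π∕4` (`Γ(s + 1) = s·Γ(s)` twice and `Γ(1∕2) = √π`). [folklore] -/
theorem Gamma_five_halves : Real.Gamma ((3 : ℕ) / 2 + 1 : ℝ) = 3 * Real.sqrt Real.pi / 4 := by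
  have h1 : Real.Gamma ((1 : ℝ) / 2 + 1) = 1 / 2 * Real.Gamma (1 / 2) := Real.Gamma_add_one (by norm_num)
  have h2 : Real.Gamma ((3 : ℝ) / 2 + 1) = 3 / 2 * Real.Gamma (3 / 2) := Real.Gamma_add_one (by norm_num)
  have h3 : (3 : ℝ) / 2 = 1 / 2 + 1 := by norm_num
  push_cast
  rw [h2, h3, h1, Real.Gamma_one_half_eq]
  ring

/-- **THE TWO CONSTANTS AGREE**: `(2∕(3π))·Γ(3∕2 + 1) = (2√π)⁻¹` — ne8's window constant `2∕(3π)` of `SU(2)` times Euler's factor IS V45's Laplace constant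
`(2√π)⁻¹ = 0.28209…` (read off Weyl's density there). [folklore] -/
theorem window_const_mul_Gamma_five_halves_eq : 2 / (3 * Real.pi) * Real.Gamma ((3 : ℕ) / 2 + 1 : ℝ) = (2 * Real.sqrt Real.pi)⁻¹ := by
  rw [Gamma_five_halves]
  have hπ := Real.pi_pos
  have hs : 0 < Real.sqrt Real.pi := Real.sqrt_pos.2 hπ
  have hss : Real.sqrt Real.pi * Real.sqrt Real.pi = Real.pi := Real.mul_self_sqrt hπ.le
  field_simp
  nlinarith [hss]

/-- **`N = 2` UNCONDITIONALLY, NO CHART, NO WEYL**: `(√β)³·∫ e^{−β·Re tr(1−U)} dHaar_{SU(2)}(U) → (2∕(3π))·Γ(3∕2 + 1)` as `β → ∞` — §2 fed with seat ne8's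
window constant `Haar_{SU(2)}{Re tr(1−V) ≤ t}∕(√t)³ → 2∕(3π)` (`LiveFactorWindowTight.tendsto_window_div_sqrt_cube`).  By `window_const_mul_Gamma_five_halves_eq`
the limit equals `(2√π)⁻¹`, i.e. this is the tree's V45 `CompactFibrePlaquetteMassSU2Limit.tendsto_scaled_plaquetteMass_SU2` (not restated here), reached by a
second, independent route. [folklore] -/
theorem tendsto_scaled_plaquetteMass_SU2_of_window :
    Tendsto (fun β : ℝ => Real.sqrt β ^ 3 *
        ∫ U, Real.exp (-(β * (Matrix.trace (1 - (U : Matrix (Fin 2) (Fin 2) ℂ))).re)) ∂(haarProbability (Matrix.specialUnitaryGroup (Fin 2) ℂ)))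
      atTop (𝓝 (2 / (3 * Real.pi) * Real.Gamma ((3 : ℕ) / 2 + 1 : ℝ))) :=
  tendsto_scaled_plaquetteMass_SUN_of_window (N := 2) (d := 3) tendsto_window_div_sqrt_cube

end SU2

/-! ## §4 (v1.1) The non-asymptotic ceiling: a window-volume ceiling at all levels gives the mass ceiling with Euler's factor at every coupling -/

section Ceiling

variable {X : Type*} [MeasurableSpace X] (μ : Measure X) [IsFiniteMeasure μ]

/-- **THE CEILING WITH EULER's FACTOR, EVERY `β`**: on a finite measure space with a measurable deficit `s ≥ 0`, if `μ{s ≤ t} ≤ M·(√t)^d` for ALL `t > 0`,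
then `∫ e^{−β·s} dμ ≤ M·Γ(d∕2 + 1)·((√β)⁻¹)^d` for EVERY `β > 0` (§1's Laplace-form layer cake `∫e^{−βs} = ∫₀^∞ e^{−u}μ{s ≤ u∕β}du` and `(√(u∕β))^d = (√u)^d·((√β)⁻¹)^d`). [folklore] -/
theorem integral_exp_neg_mul_le_of_window_le {s : X → ℝ} (hs : Measurable s) (hs0 : ∀ x, 0 ≤ s x) {d : ℕ} {M : ℝ}
    (hwin : ∀ t : ℝ, 0 < t → μ.real {x | s x ≤ t} ≤ M * Real.sqrt t ^ d) {β : ℝ} (hβ : 0 < β) :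
    ∫ x, Real.exp (-(β * s x)) ∂μ ≤ M * Real.Gamma ((d : ℝ) / 2 + 1) * (Real.sqrt β)⁻¹ ^ d := by
  rw [integral_exp_neg_mul_eq_integral_window μ hs hs0 hβ]
  have hsβ : 0 < Real.sqrt β := Real.sqrt_pos.2 hβ
  have hpt : ∀ u : ℝ, 0 < u → Real.exp (-u) * μ.real {x | s x ≤ u / β} ≤ M * (Real.sqrt β)⁻¹ ^ d * (Real.exp (-u) * Real.sqrt u ^ d) := fun u hu => by
    have h1 := hwin (u / β) (div_pos hu hβ)
    have h2 : Real.sqrt (u / β) ^ d = Real.sqrt u ^ d * (Real.sqrt β)⁻¹ ^ d := by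
      rw [Real.sqrt_div hu.le, div_pow, inv_pow, div_eq_mul_inv]
    rw [h2] at h1
    calc Real.exp (-u) * μ.real {x | s x ≤ u / β} ≤ Real.exp (-u) * (M * (Real.sqrt u ^ d * (Real.sqrt β)⁻¹ ^ d)) :=
          mul_le_mul_of_nonneg_left h1 (Real.exp_pos _).le
      _ = M * (Real.sqrt β)⁻¹ ^ d * (Real.exp (-u) * Real.sqrt u ^ d) := by ring
  have hint : IntegrableOn (fun u : ℝ => M * (Real.sqrt β)⁻¹ ^ d * (Real.exp (-u) * Real.sqrt u ^ d)) (Set.Ioi 0) :=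
    (integrableOn_exp_neg_mul_sqrt_pow d).const_mul _
  calc ∫ u in Set.Ioi (0 : ℝ), Real.exp (-u) * μ.real {x | s x ≤ u / β}
      ≤ ∫ u in Set.Ioi (0 : ℝ), M * (Real.sqrt β)⁻¹ ^ d * (Real.exp (-u) * Real.sqrt u ^ d) :=
        integral_mono_of_nonneg ((ae_restrict_iff' measurableSet_Ioi).2 (ae_of_all _ fun u _ => mul_nonneg (Real.exp_pos _).le measureReal_nonneg)) hint
          ((ae_restrict_iff' measurableSet_Ioi).2 (ae_of_all _ fun u hu => hpt u hu))
    _ = M * Real.Gamma ((d : ℝ) / 2 + 1) * (Real.sqrt β)⁻¹ ^ d := by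
        rw [integral_const_mul, integral_exp_neg_mul_sqrt_pow]; ring

end Ceiling

/-- **THE ONE-PLAQUETTE MASS CEILING FROM A WINDOW CEILING, EVERY `N`, EVERY `β > 0`**: if `Haar_{SU(N)}{Re tr(1−V) ≤ t} ≤ M·(√t)^d` for all `t > 0` then
`∫ e^{−β·Re tr(1−V)} dHaar_{SU(N)}(V) ≤ M·Γ(d∕2 + 1)·((√β)⁻¹)^d` — V39's shell ceiling with the SHARP Euler factor (for `N = 2`, V42's `(2∕(3π))(√t)³` gives J3's
`(2√π)⁻¹β^{−3∕2}`). [folklore] -/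
theorem plaquetteMass_SUN_le_of_window_le {N d : ℕ} {M : ℝ}
    (hwin : ∀ t : ℝ, 0 < t → (haarProbability (Matrix.specialUnitaryGroup (Fin N) ℂ)).real
        {V : Matrix.specialUnitaryGroup (Fin N) ℂ | (Matrix.trace (1 - (V : Matrix (Fin N) (Fin N) ℂ))).re ≤ t} ≤ M * Real.sqrt t ^ d) {β : ℝ} (hβ : 0 < β) :
    ∫ V, Real.exp (-(β * (Matrix.trace (1 - (V : Matrix (Fin N) (Fin N) ℂ))).re)) ∂(haarProbability (Matrix.specialUnitaryGroup (Fin N) ℂ))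
      ≤ M * Real.Gamma ((d : ℝ) / 2 + 1) * (Real.sqrt β)⁻¹ ^ d :=
  integral_exp_neg_mul_le_of_window_le (haarProbability (Matrix.specialUnitaryGroup (Fin N) ℂ)) measurable_re_trace_one_sub re_trace_one_sub_nonneg hwin hβ

end Summit.QuantumFields.BalabanUV.T4Continuum.NE7b.CompactFibrePlaquetteMassSUNLimit

end
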